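import Summits.BirchSwinnertonDyer.BirchSwinnertonDyer.Theorems.PrintX8SmallImageRiderBothColours
import Summits.BirchSwinnertonDyer.BirchSwinnertonDyer.Theorems.PrintX8SharpFlatRankZeroRoad
import Summits.BirchSwinnertonDyer.BirchSwinnertonDyer.Theses.PrintX8
import HarnessLib

/-!
# Route `PrintX8`, crux `MuBoundSmallImageX8` (stmt-BirchSwinnertonDyer-20622) BY NAME, analytic rank `0`:
# the crux ALONE (with the published inputs) gives the integral Euler-system half on every small-image
# X8 pair of rank `0`, hence `BSD(E,3)` where `3 ∤ #Ш_an` (54 of its 61 cells) and — with `BSD(E,3)` —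
# Sprung's Main Conjecture 7.21 there, WITHOUT K1 (cell `bsd-print-x8`, seat p3 gen 2; `--supports` 20622)

PARTITION (cell bsd-print-x8, leaf `ClassX8`): class-level readings of the route decl
`Theses.PrintX8.MuBoundSmallImageX8` CONDITIONAL on published named facts; closes NONE; 0 census cells
move; BSD is not proved by any of this. beyond-print theorem: no (bookkeeping over parts 1–4).

HONEST FRAMING. The route's `closes` consumes K1 (19875) AND Mu (20622) on the small-image pairs (glue
20623: K1 → Mu → Pub → 20402). Part 4 (`PrintX8SmallImageRiderBothColours`, §8b
`sharpFlatUpper_dvd_of_muInvariant_le`) showed that Mu's inequality at a pair and colour ALREADY makes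
Sprung 2012 Thm. 7.16's rational Kato divisibility INTEGRAL there. Read on the ROUTE DECL by name:
* §11 `upperHalf_smallImage_rankZero_of_muBoundSmallImageX8` — `MuBoundSmallImageX8` + Pub ⟹
  `ord₃ #Ш ≤ ord₃ #Ш_an` on EVERY X8 pair with `ρ̄_{E,3}` not onto and `r_an = 0` (60 cells), NO K1,
  NO rider, NO `hCK`; hence `bsdp_smallImage_rankZero_shaUnit_of_muBoundSmallImageX8` — `BSD(E,3)` on the
  54 of them with `3 ∤ #Ш_an`: on those cells the route's K1-binder is REDUNDANT (the lower half is vacuous);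
* §12 `sharpFlatMainConjecture_smallImage_rankZero_iff_bsdp_of_muBound` — GIVEN Mu (instead of K1, cf.
  p3 g1's `sharpFlatMainConjecture_smallImage_rankZero_iff_bsdp_of_K1`): on the small-image pairs of rank `0`
  the ♯/♭ main conjecture (both colours) ⟺ Miller's `BSD(E,3)`; so with §11, Mu + Pub ⟹ items 20402 and
  19875 restricted to X8 ∩ {¬surj(3)} ∩ {r_an = 0} ∩ {3 ∤ #Ш_an}.
Reading for the planner (no route change implied): on the rank-`0` small-image branch the residual of the
leaf GIVEN Mu is the lower half on the 6 cells with `3 ∣ #Ш_an` (K1 there, or the descent certificates of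
part 3) — and Mu itself ⟸ the one-colour rider (p1 g2 / part 4).

References: [Sprung2012] Thm. 7.14, Thm. 7.16 (p. 1504), Main Conj. 7.21 (p. 1505); [Sprung2024] §5.2 Lemmas
5.5–5.9; [Washington1997] §13.2; [Miller2011LMS] Def. 1.1; tree: parts 1–4 (p548892, p550798, p551403,
part 4), p3 g1 `PrintX8SmallImageRankZero` (p541386), p2 `X8SharpFlatKatoUpperHalf` (p540191).
-/

set_option autoImplicit false
-- justification: the mandated namespace `Summit.BirchSwinnertonDyer.BirchSwinnertonDyer.Theorems`
-- (single-conjunct summit, Sub = Summit) repeats a segment by design (D-0017).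
set_option linter.dupNamespace false

noncomputable section

open scoped Classical NumberField MatrixGroups ModularForm

open NumberField IsDedekindDomain WeierstrassCurve CongruenceSubgroup Field
  Literature.NumberTheory.EllipticCurves Literature.NumberTheory.EllipticCurves.ModularForms
  Literature.NumberTheory.EllipticCurves.Rank1Residual
  Literature.NumberTheory.EllipticCurves.Rank1Residual.Typed
  Literature.NumberTheory.EllipticCurves.Sprung2017 Literature.NumberTheory.EllipticCurves.Sprung2012
  Literature.NumberTheory.EllipticCurves.Sprung2024
  Literature.NumberTheory.EllipticCurves.GreenbergVatsal2000
  Literature.NumberTheory.EllipticCurves.ZpExtension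
  Summit.BirchSwinnertonDyer.BirchSwinnertonDyer.Theorems
  Summit.BirchSwinnertonDyer.BirchSwinnertonDyer.Theorems.PrintX8SmallImageRiderRankZero
  Summit.BirchSwinnertonDyer.BirchSwinnertonDyer.Theorems.PrintX8SmallImageRiderBothColours
  Summit.BirchSwinnertonDyer.BirchSwinnertonDyer.Theses.PrintX8
  Summit.BirchSwinnertonDyer.Rank1Residual.Supersingular

namespace Summit.BirchSwinnertonDyer.BirchSwinnertonDyer.Theorems.PrintX8SmallImageMuBoundRankZero

/-! ### §11 Mu BY NAME ⟹ the upper half on the rank-`0` small-image pairs, and `BSD(E,3)` where `3 ∤ #Ш_an` -/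

section UpperHalf

/-- **`MuBoundSmallImageX8` (item 20622, BY NAME) + the published inputs ⟹ `ord₃ #Ш ≤ ord₃ #Ш_an` on EVERY
X8 pair with `ρ̄_{E,3}` NOT onto and `r_an = 0`** (60 census cells). Chain per pair: the newform
(modularity `hmodf`), the Sprung pair (Sprung 2017 Thm. 1.12), a colour with `L^• ≠ 0` (Prop. 6.14), the
cyclotomic/Honda setting (Thm. 2.2 `h22`), the REAL `X^•` (Thm. 7.14 `h714`), a generator `ξ` of `char X^•`;
Mu's inequality `μ(X^•) ≤ μ(Λ/(L^•))` at these binders + Thm. 7.16's RATIONAL clause (`h716`) ⟹ `ξ ∣ L^•`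
(part 4 §8b); (K•) (`h59`) + unit-normalised interpolation (`h3`) ⟹ the upper half (p2's chain). NO K1, NO
rider, NO `hCK`, NO `Surj`. Conditional; closes nothing. [cite: Sprung2012, Thm. 2.2, Prop. 6.14, Thm. 7.14 and Thm. 7.16 (p. 1504)]
[cite: Sprung2024, §5.2 Lemmas 5.5–5.9 (pp. 40–41)] [cite: Washington1997, §13.2] [cite: Miller2011LMS, Def. 1.1] -/
theorem upperHalf_smallImage_rankZero_of_muBoundSmallImageX8
    (hmodf : exists_isNewformOf) (h22 : thm22_exists_isHondaSystem)
    (h714 : thm714_sharpFlatSelmerDual_finite_torsion) (h716 : thm716_sharpFlatCharIdeal_divisibility)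
    (h59 : lem59AllN_sharpFlatCharValue_rankZero) (h3 : realPeriodRat_eq_unit_mul_plusPeriod_three)
    (hGZK : rank_eq_analyticRank_of_analyticRank_le_one) (hmod : hasEntireLFunction_rat)
    (hMu : MuBoundSmallImageX8) :
    ∀ (W : WeierstrassCurve ℚ) [W.IsElliptic] [W.IsGloballyMinimal] (p : ℕ) [Fact p.Prime],
      ClassX8 W p → ¬ Surj W p → W.analyticRank = 0 → MissingUpperBoundAt W p := by
  intro W _ _ p _ hX hns h0
  have hp3 : p = 3 := hX.1
  subst hp3
  have hp2 : (3 : ℕ) ≠ 2 := by decide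
  have hgood : W.HasGoodReductionAtPrime 3 := hX.2.1.1
  have hdvd : ((3 : ℕ) : ℤ) ∣ W.frobeniusTrace 3 := hX.2.1.2
  have hirr : W.HasIrreducibleModPGaloisRep 3 := ClassX8.irr W 3 hX
  have hL : W.entireLFunction 1 ≠ 0 := (W.analyticRank_eq_zero_iff_holds (hmod W)).1 h0
  -- the newform, the Sprung pair, a colour with `L^• ≠ 0`
  haveI : NeZero (W.conductorNorm ℤ) := ⟨(W.conductorNorm_pos_holds).ne'⟩
  obtain ⟨f, hf⟩ := hmodf W
  obtain ⟨Lsharp, Lflat, hSP⟩ :=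
    thm112_exists_isSprungPair_holds (W := W) (f := f) (p := 3) hp2 hf hgood hdvd
  obtain ⟨col, hcol⟩ := hSP.exists_chromaticL_ne_zero hf hgood
  -- the cyclotomic setting, the place above `3`, the local lift, a Honda system (Thm. 2.2)
  obtain ⟨κ, hκ, γ, hγ, hγ'⟩ := exists_isCyclotomic_isTopGenerator_isCyclotomicVariable_holds 3
  obtain ⟨v, hv⟩ :=
    Literature.NumberTheory.NumberFields.RingOfIntegers.exists_heightOneSpectrum_natCast_mem ℚ
      (p := 3) (by norm_num)
  obtain ⟨g, hg⟩ := hκ.exists_isTopGenerator_resGalOfEmb_adicCompletion v hv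
  obtain ⟨cneg, c, hc⟩ := h22 W 3 hp2 hgood hdvd κ γ hκ hγ hγ' v hv g hg
  -- the REAL `X^•`, finitely generated torsion (Thm. 7.14), a generator of its characteristic ideal
  let D := sharpFlatSelmerDualData W κ (closureEmb (K := ℚ) (v.adicCompletion ℚ))
    (W.frobeniusTrace 3) g c col hγ
  obtain ⟨hfinD, htorD⟩ :=
    h714 W 3 hp2 hgood hdvd f hf κ γ hκ hγ hγ' v hv g hg cneg c hc col Lsharp Lflat hSP hcol D
  haveI := hfinD
  obtain ⟨gen, hgen⟩ := (charIdeal_isPrincipal_holds 3 D.X).principal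
  have hchar : D.charIdeal = Ideal.span {gen} := hgen
  have hK : (⟨gen, 0, 0⟩ : SignedDatum W 3).EulerCharacteristic := fun hfin =>
    h59 W 3 hp2 hgood hdvd hL κ γ hκ hγ hγ' v hv g hg cneg c hc col D htorD gen hchar hfin
  -- Mu's inequality at these binders, then part 4 §8b: integral Kato
  have hμ := hMu W 3 hX hns (by omega) col κ γ hκ hγ hγ' v hv g hg cneg c hc _ inferInstance f Lsharp
    Lflat hf hSP hcol D
  have hKato : gen ∣ chromaticL col Lsharp Lflat :=
    sharpFlatUpper_dvd_of_muInvariant_le h716 hp2 hgood hdvd hf hκ hγ hγ' hv hg hc hSP hcol D htorD hchar hμ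
  exact missingUpperBoundAt_of_chromaticUpperDivisibility W 3 hGZK hp2 hgood hirr hL hf
    (h3 W hgood hirr f hf) hSP col (ClassX8.not_dvd_chromaticConst' W 3 hX col) gen hK hKato

/-- **`MuBoundSmallImageX8` BY NAME + Pub ⟹ `BSD(E,3)` on X8 ∩ {ρ̄_{E,3} not onto} ∩ {r_an = 0} ∩
{ord₃ #Ш_an ≤ 0}** — 54 of the crux's 61 cells; the route's K1-binder is REDUNDANT there (lower half
vacuous). Conditional; closes nothing. [cite: Sprung2012, Thm. 7.16 (p. 1504)] [cite: Sprung2024, §5.2 Lemmas 5.5–5.9]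
[cite: Miller2011LMS, §1 and Def. 1.1] -/
theorem bsdp_smallImage_rankZero_shaUnit_of_muBoundSmallImageX8
    (hmodf : exists_isNewformOf) (h22 : thm22_exists_isHondaSystem)
    (h714 : thm714_sharpFlatSelmerDual_finite_torsion) (h716 : thm716_sharpFlatCharIdeal_divisibility)
    (h59 : lem59AllN_sharpFlatCharValue_rankZero) (h3 : realPeriodRat_eq_unit_mul_plusPeriod_three)
    (hGZK : rank_eq_analyticRank_of_analyticRank_le_one) (hmod : hasEntireLFunction_rat)
    (hMu : MuBoundSmallImageX8) :
    ∀ (W : WeierstrassCurve ℚ) [W.IsElliptic] [W.IsGloballyMinimal] (p : ℕ) [Fact p.Prime],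
      ClassX8 W p → ¬ Surj W p → W.analyticRank = 0 →
      (∃ q : ℚ, shaAn W = (q : ℂ) ∧ padicValRat p q ≤ 0) → BSDp W p := by
  intro W _ _ p _ hX hns h0 hsha
  refine bsdp_of_missingPPartAt W p hGZK (by omega) (missingPPartAt_of_lower_of_upper W p ?_
    (upperHalf_smallImage_rankZero_of_muBoundSmallImageX8 hmodf h22 h714 h716 h59 h3 hGZK hmod hMu W p hX
      hns h0))
  obtain ⟨q, hq, hle⟩ := hsha
  exact ⟨q, hq, hle.trans (by exact_mod_cast Nat.zero_le _)⟩

end UpperHalf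

/-! ### §12 GIVEN Mu (instead of K1): on the rank-`0` small-image pairs the ♯/♭ main conjecture ⟺ `BSD(E,3)` -/

section MainConjecture

variable (W : WeierstrassCurve ℚ) [W.IsElliptic] [W.IsGloballyMinimal] (p : ℕ) [Fact p.Prime]

/-- **X8 ∧ `¬ surj(3)` ∧ `r_an = 0`, colour `•`: Mu's inequality for `•` at the pair (the binder shape of
item 20622, restricted to `W` and `•`) + a SETTLED `BSD(E,3)` ⟹ Sprung's Main Conjecture 7.21 for `•`.**
Twin of p3 g1's `X8.sprungSharpFlatMainConjecture_of_lowerDivisibility_of_bsdp_of_analyticRank_eq_zero` with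
K1's predicate replaced by Mu's: integral Kato by part 4 §8b, exact form at rank `0` (b2b), Néron generator.
Named inputs: `h714`, `h716`, `h59`, `h3`, GZK, `hmod`. PER PAIR; conditional; closes nothing.
[cite: Sprung2012, Thm. 7.14, Thm. 7.16 (p. 1504) and Main Conj. 7.21 (p. 1505)]
[cite: Sprung2024, §5.2 Lemmas 5.5–5.9 (pp. 40–41)] [cite: Washington1997, §13.2] [cite: Miller2011LMS, Def. 1.1] -/
theorem X8.sprungSharpFlatMainConjecture_of_muBound_of_bsdp_of_not_surj_of_analyticRank_eq_zero
    (h714 : thm714_sharpFlatSelmerDual_finite_torsion) (h716 : thm716_sharpFlatCharIdeal_divisibility)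
    (h59 : lem59AllN_sharpFlatCharValue_rankZero) (h3 : realPeriodRat_eq_unit_mul_plusPeriod_three)
    (hGZK : rank_eq_analyticRank_of_analyticRank_le_one) (hmod : hasEntireLFunction_rat)
    (hX : ClassX8 W p) (hns : ¬ Surj W p) (h0 : W.analyticRank = 0) (hB : BSDp W p) (col : Chroma)
    (hMu : ∀ (κ : ZpExtension ℚ p) (γ : absoluteGaloisGroup ℚ),
      κ.IsCyclotomic → κ.IsTopGenerator γ → IsCyclotomicVariable p γ →
      ∀ (v : HeightOneSpectrum (𝓞 ℚ)), (p : 𝓞 ℚ) ∈ v.asIdeal →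
      ∀ (g : absoluteGaloisGroup (v.adicCompletion ℚ)),
        κ.IsTopGenerator (resGalOfEmb (closureEmb (K := ℚ) (v.adicCompletion ℚ)) g) →
      ∀ (cneg : localPoints W (v.adicCompletion ℚ)) (c : ℕ → localPoints W (v.adicCompletion ℚ)),
        IsHondaSystem κ (closureEmb (K := ℚ) (v.adicCompletion ℚ)) W (W.frobeniusTrace p) g cneg c →
      ∀ (N : ℕ) (_ : NeZero N) (f : CuspForm (Gamma0 N) 2) (Lsharp Lflat : IwasawaAlgebra p),
        IsNewformOf W f → IsSprungPair f p (W.frobeniusTrace p) Lsharp Lflat →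
        chromaticL col Lsharp Lflat ≠ 0 →
      ∀ D : SharpFlatSelmerDualData W κ γ (closureEmb (K := ℚ) (v.adicCompletion ℚ))
          (W.frobeniusTrace p) g c col,
        muInvariant p D.X ≤ muInvariant p (IwasawaAlgebra p ⧸ Ideal.span {chromaticL col Lsharp Lflat})) :
    SprungSharpFlatMainConjecture W p col := by
  intro κ γ hκ hγ hγ' v hv g hg cneg c hc N hN f ϖ Lsharp Lflat hf hϖ hSP hcol D
  haveI := hN
  have hp3 : p = 3 := hX.1
  subst hp3
  have hp2 : (3 : ℕ) ≠ 2 := by decide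
  have hgood : W.HasGoodReductionAtPrime 3 := hX.2.1.1
  have hdvd : ((3 : ℕ) : ℤ) ∣ W.frobeniusTrace 3 := hX.2.1.2
  have hirr : W.HasIrreducibleModPGaloisRep 3 := ClassX8.irr W 3 hX
  have hL : W.entireLFunction 1 ≠ 0 := (W.analyticRank_eq_zero_iff_holds (hmod W)).1 h0
  obtain ⟨hfinD, htorD⟩ :=
    h714 W 3 hp2 hgood hdvd f hf κ γ hκ hγ hγ' v hv g hg cneg c hc col Lsharp Lflat hSP hcol D
  haveI := hfinD
  obtain ⟨gen, hgen⟩ := (charIdeal_isPrincipal_holds 3 D.X).principal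
  have hchar : D.charIdeal = Ideal.span {gen} := hgen
  have hK : (⟨gen, 0, 0⟩ : SignedDatum W 3).EulerCharacteristic := fun hfin =>
    h59 W 3 hp2 hgood hdvd hL κ γ hκ hγ hγ' v hv g hg cneg c hc col D htorD gen hchar hfin
  have hμ := hMu κ γ hκ hγ hγ' v hv g hg cneg c hc N hN f Lsharp Lflat hf hSP hcol D
  have hKato : gen ∣ chromaticL col Lsharp Lflat :=
    sharpFlatUpper_dvd_of_muInvariant_le h716 hp2 hgood hdvd hf hκ hγ hγ' hv hg hc hSP hcol D htorD hchar hμ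
  have hspan : Ideal.span ({gen} : Set (IwasawaAlgebra 3)) =
      Ideal.span {chromaticL col Lsharp Lflat} :=
    (bsdp_iff_span_eq_span_chromaticL_of_analyticRank_eq_zero W 3 hGZK hp2 hgood hirr hL hf
      (h3 W hgood hirr f hf) hSP col (ClassX8.not_dvd_chromaticConst' W 3 hX col) gen hK hKato).mp hB
  have hϖ1 : ‖(ϖ : ℚ_[3])‖ = 1 := X8_norm_periodRatio_eq_one h3 W 3 hX hf hϖ
  obtain ⟨hspan', hι'⟩ := span_C_units_mul_eq (PadicInt.mkUnits hϖ1) (chromaticL col Lsharp Lflat)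
  refine ⟨htorD, PowerSeries.C ((PadicInt.mkUnits hϖ1 : ℤ_[3]ˣ) : ℤ_[3]) *
    chromaticL col Lsharp Lflat, ?_, ?_⟩
  · rw [hchar, hspan, hspan']
  · rw [hι', PadicInt.mkUnits_eq]

/-- **CLASS FORM at rank `0`: GIVEN Mu (item 20622 BY NAME) and the print, on the small-image X8 pairs of
analytic rank `0` the ♯/♭ main conjecture (both colours) is EQUIVALENT to Miller's `BSD(E,3)`** — the twin
of p3 g1's `sharpFlatMainConjecture_smallImage_rankZero_iff_bsdp_of_K1` with K1 replaced by Mu (⇒: p1's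
image-free rank-zero road `X8MainConjectureRoad.X8.bsdp_of_sprungSharpFlatMainConjecture_of_analyticRank_eq_zero`;
⇐: the previous theorem). Reading: on those 60 cells K1 and Mu are INTERCHANGEABLE inputs next to
`BSD(E,3)`. Conditional; closes nothing. [cite: Sprung2012, Main Conj. 7.21 (p. 1505)]
[cite: Sprung2024, Thm. 5.3 (p. 38) and §5.2 (pp. 39–41)] [cite: Miller2011LMS, Def. 1.1] -/
theorem sharpFlatMainConjecture_smallImage_rankZero_iff_bsdp_of_muBound
    (hmodf : exists_isNewformOf) (h22 : thm22_exists_isHondaSystem)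
    (h714 : thm714_sharpFlatSelmerDual_finite_torsion) (h716 : thm716_sharpFlatCharIdeal_divisibility)
    (h59 : lem59AllN_sharpFlatCharValue_rankZero) (h3 : realPeriodRat_eq_unit_mul_plusPeriod_three)
    (hGZK : rank_eq_analyticRank_of_analyticRank_le_one) (hmod : hasEntireLFunction_rat)
    (hMu : MuBoundSmallImageX8) :
    (∀ (W : WeierstrassCurve ℚ) [W.IsElliptic] [W.IsGloballyMinimal] (p : ℕ) [Fact p.Prime],
        ClassX8 W p → ¬ Surj W p → W.analyticRank = 0 →
        ∀ col : Chroma, SprungSharpFlatMainConjecture W p col) ↔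
      (∀ (W : WeierstrassCurve ℚ) [W.IsElliptic] [W.IsGloballyMinimal] (p : ℕ) [Fact p.Prime],
        ClassX8 W p → ¬ Surj W p → W.analyticRank = 0 → BSDp W p) :=
  ⟨fun hMC W _ _ p _ hX hns h0 ↦
      X8MainConjectureRoad.X8.bsdp_of_sprungSharpFlatMainConjecture_of_analyticRank_eq_zero hmodf h22
        h714 h59 h3 hGZK hmod W p hX h0 (hMC W p hX hns h0),
    fun hB W _ _ p _ hX hns h0 col ↦
      X8.sprungSharpFlatMainConjecture_of_muBound_of_bsdp_of_not_surj_of_analyticRank_eq_zero W p h714 h716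
        h59 h3 hGZK hmod hX hns h0 (hB W p hX hns h0) col
        (fun κ γ hκ hγ hγ' v hv g hg cneg c hc N hN f Lsharp Lflat hf hSP hcol D ↦
          hMu W p hX hns (by omega) col κ γ hκ hγ hγ' v hv g hg cneg c hc N hN f Lsharp Lflat hf hSP hcol D)⟩

/-- **Mu BY NAME + Pub ⟹ items 20402 AND 19875 restricted to X8 ∩ {¬surj(3)} ∩ {r_an = 0} ∩ {3 ∤ #Ш_an}**
(54 of the 61 small-image cells): §11 gives `BSD(E,3)`, §12 the main conjecture for both colours, the edge
its Eisenstein half. K1-FREE. Conditional; closes nothing. [cite: Sprung2012, Main Conj. 1.3 (p. 1486) and Main Conj. 7.21 (p. 1505)]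
[cite: Sprung2024, §5.2 Lemmas 5.5–5.9] [cite: Miller2011LMS, Def. 1.1] -/
theorem sharpFlatMainConjecture_smallImage_rankZero_shaUnit_of_muBoundSmallImageX8
    (hmodf : exists_isNewformOf) (h22 : thm22_exists_isHondaSystem)
    (h714 : thm714_sharpFlatSelmerDual_finite_torsion) (h716 : thm716_sharpFlatCharIdeal_divisibility)
    (h59 : lem59AllN_sharpFlatCharValue_rankZero) (h3 : realPeriodRat_eq_unit_mul_plusPeriod_three)
    (hGZK : rank_eq_analyticRank_of_analyticRank_le_one) (hmod : hasEntireLFunction_rat)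
    (hMu : MuBoundSmallImageX8) :
    ∀ (W : WeierstrassCurve ℚ) [W.IsElliptic] [W.IsGloballyMinimal] (p : ℕ) [Fact p.Prime],
      ClassX8 W p → ¬ Surj W p → W.analyticRank = 0 →
      (∃ q : ℚ, shaAn W = (q : ℂ) ∧ padicValRat p q ≤ 0) →
      ∀ col : Chroma, SprungSharpFlatMainConjecture W p col ∧ SprungSharpFlatLowerDivisibility W p col := by
  intro W _ _ p _ hX hns h0 hsha col
  have hB : BSDp W p :=
    bsdp_smallImage_rankZero_shaUnit_of_muBoundSmallImageX8 hmodf h22 h714 h716 h59 h3 hGZK hmod hMu W p hX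
      hns h0 hsha
  have hMC : SprungSharpFlatMainConjecture W p col :=
    X8.sprungSharpFlatMainConjecture_of_muBound_of_bsdp_of_not_surj_of_analyticRank_eq_zero W p h714 h716
      h59 h3 hGZK hmod hX hns h0 hB col
      (fun κ γ hκ hγ hγ' v hv g hg cneg c hc N hN f Lsharp Lflat hf hSP hcol D ↦
        hMu W p hX hns (by omega) col κ γ hκ hγ hγ' v hv g hg cneg c hc N hN f Lsharp Lflat hf hSP hcol D)
  exact ⟨hMC, sprungSharpFlatLowerDivisibility_of_mainConjecture hMC⟩

end MainConjecture

end Summit.BirchSwinnertonDyer.BirchSwinnertonDyer.Theorems.PrintX8SmallImageMuBoundRankZero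

end
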